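import Mathlib
import Summits.Ventures.FusionMHD.Models.CerfonFreidbergIterLikeQHalfResDefs
import HarnessLib

/-!
# Ventures/FusionMHD — Models/CerfonFreidbergIterLikeQHalfResPanels13.lean: KERNEL CHECK of the resistive-register certificates of panel(s) 22, 23 (of 32)
# at `ψ_N = 1/2` of THE Cerfon–Freidberg ITER-like instance

HONEST FRAMING (LADDER-GRIDFUSION three columns; CF rung; rider «D_R at ψ_N = 1/2»).  One `decide +kernel` (≈ 60–90 s): for each listed panel the obligation
`CFIterLike.QHalfRes.ResCert.ok` (`Models/CerfonFreidbergIterLikeQHalfResDefs.lean`) — the Taylor-model run of `progR = progM ++ block3R` over ★ #117's parameter box is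
ACCEPTED and the kernel's two panel-integral enclosures (`g_AG`, `g_W` along the approximant) lie inside the claimed integers (compiled `#eval` of the same functions, slack
one unit of `2⁻⁶⁰`; float truth inside every panel, `genqm/truthR.json`).  MODELLED: analytic Cerfon–Freidberg family; nothing about a device or stability.
No `native_decide`.  Typer/prover: gridfusion-model-7 (g7), 2026-08-28.  Citations: Zheng 2015 §3.2 (3.42) [Zheng2015];
Mahboubi–Melquiond–Sibut-Pinote 2016 §3.2 Lemma 3 [MahboubiMelquiondSibutpinote2016].
-/

namespace Summit.Ventures.FusionMHD.Models.CFIterLike.QHalfRes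

/-- Resistive-register certificate data of panel(s) 22, 23. [instance data] -/
def resCert13 : List ResCert := [
  { j := 22, cand1 := [2031168602596235542528, -9611877739688668168192, -12699519640848918642688, 502383215775496290697216, -2898307893849208104419328, 284921959784770487451648, 109989829522833843595247616, -767390678364198160599875584, 1123323987238545131376214016, 21071536078089759809385529344, -188166839274606404205356777472, 459550871679991347767142252544, 6181987795578104851818744905728],
    cand2 := [1345510980228361748480, -8165447669953579712512, 34881148436280565039104, 36685593188411144929280, -2024424228028421955911680, 19513071454824205459128320, -107988685713479243994759168, 203749673584150401301610496, 3001889531584210751698501632, -41324125453323058481440227328, 292733502288683221143154327552, -1055018560034555833464750342144, -2859407020086409570497012432896],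
    deg := 10, e1 := 46, e2 := 45, glo := 5161081065401357, ghi := 5161081601056130, wlo := 342148449513044657, whi := 342148481569101774 },
  { j := 23, cand1 := [1731053089240692031488, -9271159285405465968640, 18641350618719581110272, 187352864510902964060160, -1939066182653763500638208, 8473953375524915339329536, -2340213034597462581444608, -241294781508618583155933184, 1839996656742917764766760960, -6271659723907607572523253760, -5188427611844559596205113344, 300932953341633499680041074688, -6391472097718218835260172402688],
    cand2 := [1124081953180703391744, -6049523739177367109632, 31041421979231541264384, -82287993465011120898048, -247910281625816098930688, 5334345372395098874052608, -43536833419549440011665408, 241136546961123908087971840, -855974075727780920789303296, 49213877726695940249616384, 36409996141368794890821959680, -308977048308636901552013967360, -7920127059354654509361222647808],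
    deg := 10, e1 := 45, e2 := 45, glo := 5326132801586380, ghi := 5326133156461807, wlo := 299712622457627425, whi := 299712640215287756 }]

/-- **KERNEL CHECK** of the two resistive registers on panel(s) 22, 23. -/
theorem resCert13_ok : CFIterLike.QHalfRes.resCert13.all ResCert.ok = true := by
  decide +kernel

end Summit.Ventures.FusionMHD.Models.CFIterLike.QHalfRes
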